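/-
Copyright (c) 2026. All rights reserved.
Released under Apache 2.0 license as described in the file LICENSE.
Authors: HodgeCM publication cell (pub-hodgecm), GR lane, seat GR-2 (`pub-hodgecm-own-hyp34`).
-/
import Literature.NumberTheory.Automorphic.UnitaryGroupArchimedean
import Literature.NumberTheory.Weil1964.ArchSplitRealPlaceSection
import Mathlib.Algebra.Order.Archimedean.Real.Hom
import HarnessLib

/-!
# The archimedean factor of `U(J)(E ⊗ ℝ)` at a real place of `F` that SPLITS in `E`, and its metaplectic section

Topic `NumberTheory/Automorphic`; namespace `Literature.NumberTheory.Automorphic.UnitaryGroup` (continues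
`UnitaryGroupArchimedean`, `UnitaryGroupArchimedeanPlaces`).  KERNEL ONLY: definitions with bodies and theorems;
no `def … : Prop` record, no `axiom`, no proof hole.

Setting: `E/F` number fields, `c : E ≃ₐ[F] E` an involution (`hcc : c * c = 1` — the non-trivial automorphism of a
quadratic extension), `J ∈ M_N(E)`, and a REAL place `w` of `E` with `c • w ≠ w` — equivalently the real place
`v = w|_F` of `F` SPLITS in `E`, the two places over it being `w` and `c • w`, `E ⊗_F F_v = E_w × E_{c w} = ℝ × ℝ`
([PlatonovRapinchuk1994, §2.3 and §3.2]: at such a place the unitary group is `GL_N`; [MoeglinVignerasWaldspurger1987,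
Chap. 1 I.17–I.19]).  The CM situation (`UnitaryGroupArchimedeanPlaces`: every infinite place complex and fixed by
`c`) never has such a place; a general quadratic extension (e.g. a real quadratic one) does.

* §1 **`c ⊗ 1` PERMUTES the real coordinates of `E ⊗ ℝ = ℝ^{r₁} × ℂ^{r₂}`**: `((c ⊗ 1) x)_{w} = x_{c⁻¹ w}`
  (`conjMixed_fst_eq`; the coordinate map `E_{c⁻¹w} → E_w → ℝ` is a ring homomorphism `ℝ → ℝ`, hence the identity —
  Mathlib `Real.RingHom.unique`); so at the pair `(w, c w)` the two-coordinate evaluation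
  **`evalRR w : E ⊗ ℝ →+* ℝ × ℝ`** intertwines `c ⊗ 1` with the SWAP (`evalRR_conjMixed`).
* §2 **`archAtRealPair w : U(J)(E ⊗ ℝ) →* U(swap, J_{w, cw})(ℝ × ℝ)`**, the `(w, c w)`-component (continuous), where
  `U(swap, H) = {g ∈ GL_N(ℝ × ℝ) | (swap g)ᵀ H g = H}` is the tree's `unitaryGroupOfForm` over the split algebra `ℝ × ℝ`
  (≅ `GL_N(ℝ)` by the first projection); for `J = T ⊗_F E` with `T ∈ M_N(F)`: `J_{w, cw} = σ_v(T) ⊗ 1`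
  (`archFormOf_map_evalRR_of_map`, using `(c • w).embedding = w.embedding ∘ c⁻¹` for real `w`, `embedding_smul_of_isReal`),
  packaged as `archAtRealSplit`.
* §3 composing with the split-real metaplectic section of `Weil1964/ArchSplitRealPlaceSection` (L5 of the general-`E/F`
  programme): **`archSectionRealSplit … : U(J)(E ⊗ ℝ) →* Mp^𝓢(ℝ^N)`**, a homomorphism over the symplectic embedding of
  the `(w, cw)`-factor (`proj_comp_archSectionRealSplit`) — the archimedean Weil section AT A REAL PLACE OF `F` SPLIT IN
  `E`, strongly continuous (`continuous_archSectionRealSplit_snd_apply`).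

## References
* [PlatonovRapinchuk1994] V. Platonov, A. Rapinchuk, *Algebraic Groups and Number Theory* (1994), §2.3, §3.2.
* [MoeglinVignerasWaldspurger1987] C. Mœglin, M.-F. Vignéras, J.-L. Waldspurger, LNM 1291 (1987), Chap. 1 I.17–I.19.
* [BorelJacquet1979] A. Borel, H. Jacquet, PSPM 33.1 (1979), §4.1 (archimedean components of adelic groups).
* [Kudla1994] S. S. Kudla, Israel J. Math. 87 (1994), §3.
-/

set_option autoImplicit false

noncomputable section

open NumberField NumberField.InfinitePlace NumberField.mixedEmbedding
open Literature.RepresentationTheory.HeisenbergGroup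
open Literature.NumberTheory.Weil1964

namespace Literature.NumberTheory.Automorphic

namespace UnitaryGroup

variable (F E : Type) [Field F] [Field E] [NumberField E] [Algebra F E] (c : E ≃ₐ[F] E) (N : ℕ)
  (J : Matrix (Fin N) (Fin N) E)

/-! ## §1 `c ⊗ 1` on the real coordinates; the two-coordinate evaluation at a pair of real places -/

omit [NumberField E] in
/-- **`((c ⊗ 1) x)_w = x_{c⁻¹ w}` at a REAL place `w`**: the coordinate transport `E_{c⁻¹ w} ≅ ℝ → E_w ≅ ℝ` is a ring
homomorphism `ℝ → ℝ`, hence the identity. [cite: PlatonovRapinchuk1994, §2.3] -/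
theorem conjMixed_fst_eq (x : mixedSpace E) (w : {w : InfinitePlace E // IsReal w}) :
    (conjMixed F E c x).1 w = x.1 ⟨c⁻¹ • w.1, isReal_smul_iff.mpr w.2⟩ := by
  rw [conjMixed_fst_apply]
  set ψ : ℝ →+* ℝ := (Completion.ringEquivRealOfIsReal w.2).toRingHom.comp
    ((galInfiniteCompletionMap c (smul_inv_smul c w.1)).comp
      (Completion.ringEquivRealOfIsReal (isReal_smul_iff.mpr w.2 : IsReal (c⁻¹ • w.1))).symm.toRingHom) with hψ
  have hψ1 : ψ = RingHom.id ℝ := Subsingleton.elim _ _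
  exact DFunLike.congr_fun hψ1 (x.1 ⟨c⁻¹ • w.1, isReal_smul_iff.mpr w.2⟩)

/-- evaluation at a real coordinate: `x ↦ x_w`. [cite: PlatonovRapinchuk1994, §2.3] -/
def evalR (w : {w : InfinitePlace E // IsReal w}) : mixedSpace E →+* ℝ := (Pi.evalRingHom _ w).comp (RingHom.fst _ _)

omit [NumberField E] in
/-- unfolding. [cite: PlatonovRapinchuk1994, §2.3] -/
@[simp] theorem evalR_apply (w : {w : InfinitePlace E // IsReal w}) (x : mixedSpace E) : evalR E w x = x.1 w := rfl

/-- the PARTNER `c • w` of a real place `w` (real: `isReal_smul_iff`). [cite: PlatonovRapinchuk1994, §3.2] -/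
def cPlace (w : {w : InfinitePlace E // IsReal w}) : {w : InfinitePlace E // IsReal w} :=
  ⟨c • w.1, isReal_smul_iff.mpr w.2⟩

omit [NumberField E] in
/-- unfolding. [cite: PlatonovRapinchuk1994, §3.2] -/
@[simp] theorem coe_cPlace (w : {w : InfinitePlace E // IsReal w}) : (cPlace F E c w).1 = c • w.1 := rfl

omit [NumberField E] in
/-- for an involution `c`, `c⁻¹ • w = c • w`. [cite: PlatonovRapinchuk1994, §3.2] -/
theorem inv_smul_eq_smul_of_mul_self (hcc : c * c = 1) (w : InfinitePlace E) : c⁻¹ • w = c • w := by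
  have h : c⁻¹ = c := inv_eq_of_mul_eq_one_right hcc
  rw [h]

omit [NumberField E] in
/-- `((c ⊗ 1) x)_w = x_{cw}` for an involution `c`. [cite: PlatonovRapinchuk1994, §2.3] -/
theorem evalR_conjMixed (hcc : c * c = 1) (w : {w : InfinitePlace E // IsReal w}) (x : mixedSpace E) :
    evalR E w (conjMixed F E c x) = evalR E (cPlace F E c w) x := by
  rw [evalR_apply, evalR_apply, conjMixed_fst_eq]
  exact congrArg x.1 (Subtype.ext (inv_smul_eq_smul_of_mul_self F E c hcc w.1))

omit [NumberField E] in
/-- `((c ⊗ 1) x)_{cw} = x_w`. [cite: PlatonovRapinchuk1994, §2.3] -/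
theorem evalR_cPlace_conjMixed (w : {w : InfinitePlace E // IsReal w}) (x : mixedSpace E) :
    evalR E (cPlace F E c w) (conjMixed F E c x) = evalR E w x := by
  rw [evalR_apply, evalR_apply, conjMixed_fst_eq]
  exact congrArg x.1 (Subtype.ext (inv_smul_smul c w.1))

/-- **`evalRR w : E ⊗ ℝ →+* ℝ × ℝ`**, `x ↦ (x_w, x_{cw})` — the projection onto `E ⊗_F F_v = E_w × E_{cw}`.
[cite: PlatonovRapinchuk1994, §3.2] -/
def evalRR (w : {w : InfinitePlace E // IsReal w}) : mixedSpace E →+* ℝ × ℝ := (evalR E w).prod (evalR E (cPlace F E c w))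

omit [NumberField E] in
/-- unfolding. [cite: PlatonovRapinchuk1994, §3.2] -/
@[simp] theorem evalRR_apply (w : {w : InfinitePlace E // IsReal w}) (x : mixedSpace E) :
    evalRR F E c w x = (x.1 w, x.1 (cPlace F E c w)) := rfl

omit [NumberField E] in
/-- `evalRR` is continuous. [cite: PlatonovRapinchuk1994, §3.2] -/
theorem continuous_evalRR (w : {w : InfinitePlace E // IsReal w}) : Continuous (evalRR F E c w) :=
  Continuous.prodMk ((continuous_apply w).comp continuous_fst) ((continuous_apply _).comp continuous_fst)

omit [NumberField E] in
/-- **`evalRR ((c ⊗ 1) x) = swap (evalRR x)`**: at the pair `(w, cw)` the conjugation `c ⊗ 1` IS the swap of the two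
real factors. [cite: PlatonovRapinchuk1994, §3.2; MoeglinVignerasWaldspurger1987, Chap. 1 I.17] -/
theorem evalRR_conjMixed (hcc : c * c = 1) (w : {w : InfinitePlace E // IsReal w}) (x : mixedSpace E) :
    evalRR F E c w (conjMixed F E c x) = (RingEquiv.prodComm : ℝ × ℝ ≃+* ℝ × ℝ).toRingHom (evalRR F E c w x) := by
  refine Prod.ext ?_ ?_
  · exact evalR_conjMixed F E c hcc w x
  · exact evalR_cPlace_conjMixed F E c w x

/-! ## §2 The `(w, cw)`-component of `U(J)(E ⊗ ℝ)` -/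

omit [NumberField E] in
/-- the `(w, cw)`-coordinates of `J ⊗ 1`. [cite: BorelJacquet1979, §4.1] -/
theorem archFormOf_map_evalRR (w : {w : InfinitePlace E // IsReal w}) :
    (archFormOf E N J).map (evalRR F E c w) = J.map ((evalRR F E c w).comp (mixedEmbedding E)) := by
  rw [archFormOf, Matrix.map_map]
  rfl

/-- **`archAtRealPair w : U(J)(E ⊗ ℝ) →* U(swap, J_{w,cw})(ℝ × ℝ)`**, the `(w, cw)`-component of an archimedean
unitary matrix (restriction of `GL_N(evalRR w)`; membership: `map_mem_unitaryGroupOfForm` along `evalRR_conjMixed`).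
[cite: BorelJacquet1979, §4.1; PlatonovRapinchuk1994, §3.2] -/
def archAtRealPair (hcc : c * c = 1) (w : {w : InfinitePlace E // IsReal w}) :
    arch F E c N J →*
      unitaryGroupOfForm (RingEquiv.prodComm : ℝ × ℝ ≃+* ℝ × ℝ).toRingHom (J.map ((evalRR F E c w).comp (mixedEmbedding E))) :=
  ((Matrix.GeneralLinearGroup.map (evalRR F E c w)).restrict (arch F E c N J)).codRestrict _ fun g => by
    have h := map_mem_unitaryGroupOfForm (σ := conjMixed F E c)
      (τ := (RingEquiv.prodComm : ℝ × ℝ ≃+* ℝ × ℝ).toRingHom) (evalRR F E c w) (evalRR_conjMixed F E c hcc w) g.2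
    rw [archFormOf_map_evalRR] at h
    exact h

omit [NumberField E] in
/-- underlying invertible matrix. [cite: BorelJacquet1979, §4.1] -/
@[simp] theorem coe_archAtRealPair (hcc : c * c = 1) (w : {w : InfinitePlace E // IsReal w}) (g : arch F E c N J) :
    ((archAtRealPair F E c N J hcc w g : unitaryGroupOfForm _ _) : GL (Fin N) (ℝ × ℝ)) =
      Matrix.GeneralLinearGroup.map (evalRR F E c w) (g : GL (Fin N) (mixedSpace E)) := rfl

omit [NumberField E] in
/-- entries: `(archAtRealPair w g)ᵢⱼ = ((gᵢⱼ)_w, (gᵢⱼ)_{cw})`. [cite: BorelJacquet1979, §4.1] -/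
theorem coe_archAtRealPair_apply (hcc : c * c = 1) (w : {w : InfinitePlace E // IsReal w}) (g : arch F E c N J)
    (i j : Fin N) :
    (((archAtRealPair F E c N J hcc w g : unitaryGroupOfForm _ _) : GL (Fin N) (ℝ × ℝ)) : Matrix (Fin N) (Fin N) (ℝ × ℝ))
        i j =
      ((((g : GL (Fin N) (mixedSpace E)) : Matrix (Fin N) (Fin N) (mixedSpace E)) i j).1 w,
        (((g : GL (Fin N) (mixedSpace E)) : Matrix (Fin N) (Fin N) (mixedSpace E)) i j).1 (cPlace F E c w)) := rfl

omit [NumberField E] in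
/-- `archAtRealPair w` is continuous. [cite: BorelJacquet1979, §4.1] -/
theorem continuous_archAtRealPair (hcc : c * c = 1) (w : {w : InfinitePlace E // IsReal w}) :
    Continuous (archAtRealPair F E c N J hcc w) :=
  (((continuous_evalRR F E c w).generalLinearGroup_map :
      Continuous (Matrix.GeneralLinearGroup.map (n := Fin N) (evalRR F E c w))).comp continuous_subtype_val).subtype_mk _

/-! ### The Gram matrix at a split real place for `J = T ⊗_F E` -/

section Rational

variable [NumberField F]

omit [NumberField E] [NumberField F] in
/-- **for a REAL place `w`, `(c • w).embedding = w.embedding ∘ c⁻¹`** (a real embedding is determined by its place).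
[cite: PlatonovRapinchuk1994, §2.3] -/
theorem embedding_smul_of_isReal (w : {w : InfinitePlace E // IsReal w}) :
    (c • w.1).embedding = w.1.embedding.comp (c.symm : E →+* E) := by
  have hr : ComplexEmbedding.IsReal (w.1.embedding.comp (c.symm : E →+* E)) :=
    ComplexEmbedding.IsReal.comp _ (isReal_iff.mp w.2)
  have hw : c • w.1 = mk (w.1.embedding.comp (c.symm : E →+* E)) := by
    conv_lhs => rw [← mk_embedding w.1]
    rw [smul_mk]
  rw [hw, embedding_mk_eq_of_isReal hr]

omit [NumberField E] [NumberField F] in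
/-- hence the real embeddings of `w` and `c • w` agree on `F`. [cite: PlatonovRapinchuk1994, §2.3] -/
theorem embedding_of_isReal_cPlace_algebraMap (w : {w : InfinitePlace E // IsReal w}) (t : F) :
    embedding_of_isReal (cPlace F E c w).2 (algebraMap F E t) = embedding_of_isReal w.2 (algebraMap F E t) := by
  apply Complex.ofReal_injective
  rw [embedding_of_isReal_apply, embedding_of_isReal_apply, coe_cPlace, embedding_smul_of_isReal, RingHom.comp_apply,
    RingHom.coe_coe, AlgEquiv.commutes]

omit [NumberField E] [NumberField F] in
/-- and take opposite values on an anti-invariant `δ` (`c δ = -δ`): `σ_{cw}(δ) = -σ_w(δ)`. [cite: PlatonovRapinchuk1994, §2.3] -/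
theorem embedding_of_isReal_cPlace_delta (w : {w : InfinitePlace E // IsReal w}) {δ : E} (hcδ : c δ = -δ) :
    embedding_of_isReal (cPlace F E c w).2 δ = -embedding_of_isReal w.2 δ := by
  apply Complex.ofReal_injective
  have hδ' : c.symm δ = -δ := by
    apply c.injective
    rw [AlgEquiv.apply_symm_apply, map_neg, hcδ, neg_neg]
  rw [Complex.ofReal_neg, embedding_of_isReal_apply, embedding_of_isReal_apply, coe_cPlace, embedding_smul_of_isReal,
    RingHom.comp_apply, RingHom.coe_coe, hδ', map_neg]

/-- the real embedding of `F` under the real place `w` of `E`: `σ_v = σ_w|_F`. [cite: PlatonovRapinchuk1994, §2.3] -/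
def realEmbOfPlace (w : {w : InfinitePlace E // IsReal w}) : F →+* ℝ := (embedding_of_isReal w.2).comp (algebraMap F E)

omit [NumberField E] [NumberField F] in
/-- `evalRR (x ⊗ 1) = (σ_w x, σ_{cw} x)`. [cite: PlatonovRapinchuk1994, §3.2] -/
theorem evalRR_mixedEmbedding (w : {w : InfinitePlace E // IsReal w}) (x : E) :
    evalRR F E c w (mixedEmbedding E x) = (embedding_of_isReal w.2 x, embedding_of_isReal (cPlace F E c w).2 x) := by
  rw [evalRR_apply, mixedEmbedding_apply_isReal, mixedEmbedding_apply_isReal]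

omit [NumberField E] [NumberField F] in
/-- on `F`: `evalRR (t ⊗ 1) = (σ_v t, σ_v t)`, the diagonal. [cite: PlatonovRapinchuk1994, §3.2] -/
theorem evalRR_mixedEmbedding_algebraMap (w : {w : InfinitePlace E // IsReal w}) (t : F) :
    evalRR F E c w (mixedEmbedding E (algebraMap F E t)) =
      ((RingHom.id ℝ).prod (RingHom.id ℝ)) (realEmbOfPlace F E w t) := by
  rw [evalRR_mixedEmbedding, embedding_of_isReal_cPlace_algebraMap]
  rfl

omit [NumberField E] [NumberField F] in
/-- **the Gram matrix of the `(w, cw)`-factor for `J = T ⊗_F E` is `σ_v(T) ⊗ 1`**.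
[cite: PlatonovRapinchuk1994, §3.2; BorelJacquet1979, §4.1] -/
theorem map_evalRR_mixedEmbedding_of_map (w : {w : InfinitePlace E // IsReal w}) (T : Matrix (Fin N) (Fin N) F) :
    (T.map (algebraMap F E)).map ((evalRR F E c w).comp (mixedEmbedding E)) =
      (T.map (realEmbOfPlace F E w)).map ((RingHom.id ℝ).prod (RingHom.id ℝ)) := by
  ext i j : 1
  simp only [Matrix.map_apply]
  exact evalRR_mixedEmbedding_algebraMap F E c w (T i j)

/-- **`archAtRealSplit w : U(T ⊗ E)(E ⊗ ℝ) →* U(swap, σ_v(T) ⊗ 1)(ℝ × ℝ)`** — the `(w, cw)`-component for a form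
defined over `F`, in the currency of `Weil1964/ArchSplitRealPlaceSection`. [cite: BorelJacquet1979, §4.1] -/
def archAtRealSplit (hcc : c * c = 1) (w : {w : InfinitePlace E // IsReal w}) (T : Matrix (Fin N) (Fin N) F)
    {J : Matrix (Fin N) (Fin N) E} (hJ : J = T.map (algebraMap F E)) :
    arch F E c N J →*
      unitaryGroupOfForm (RingEquiv.prodComm : ℝ × ℝ ≃+* ℝ × ℝ).toRingHom
        ((T.map (realEmbOfPlace F E w)).map ((RingHom.id ℝ).prod (RingHom.id ℝ))) :=
  (Subgroup.inclusion (le_of_eq (congrArg (unitaryGroupOfForm (RingEquiv.prodComm : ℝ × ℝ ≃+* ℝ × ℝ).toRingHom)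
      (by rw [hJ, map_evalRR_mixedEmbedding_of_map])))).comp
    (archAtRealPair F E c N J hcc w)

omit [NumberField E] [NumberField F] in
/-- underlying invertible matrix. [cite: BorelJacquet1979, §4.1] -/
@[simp] theorem coe_archAtRealSplit (hcc : c * c = 1) (w : {w : InfinitePlace E // IsReal w})
    (T : Matrix (Fin N) (Fin N) F) {J : Matrix (Fin N) (Fin N) E} (hJ : J = T.map (algebraMap F E)) (g : arch F E c N J) :
    ((archAtRealSplit F E c N hcc w T hJ g : unitaryGroupOfForm _ _) : GL (Fin N) (ℝ × ℝ)) =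
      Matrix.GeneralLinearGroup.map (evalRR F E c w) (g : GL (Fin N) (mixedSpace E)) := rfl

omit [NumberField E] [NumberField F] in
/-- `archAtRealSplit` is continuous. [cite: BorelJacquet1979, §4.1] -/
theorem continuous_archAtRealSplit (hcc : c * c = 1) (w : {w : InfinitePlace E // IsReal w})
    (T : Matrix (Fin N) (Fin N) F) {J : Matrix (Fin N) (Fin N) E} (hJ : J = T.map (algebraMap F E)) :
    Continuous (archAtRealSplit F E c N hcc w T hJ) := by
  refine Continuous.subtype_mk ?_ _
  exact ((continuous_evalRR F E c w).generalLinearGroup_map :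
      Continuous (Matrix.GeneralLinearGroup.map (n := Fin N) (evalRR F E c w))).comp continuous_subtype_val

/-! ## §3 The metaplectic section at a real place of `F` split in `E` -/

omit [NumberField E] [NumberField F] in
/-- `σ_w(δ) ≠ 0` for `δ ≠ 0`. [cite: PlatonovRapinchuk1994, §2.3] -/
theorem embedding_of_isReal_ne_zero (w : {w : InfinitePlace E // IsReal w}) {δ : E} (hδ : δ ≠ 0) :
    embedding_of_isReal w.2 δ ≠ 0 :=
  (map_ne_zero_iff _ (embedding_of_isReal w.2).injective).mpr hδ

/-- **`archSectionRealSplit … x : U(T ⊗ E)(E ⊗ ℝ) →* Mp^𝓢(ℝ^N)`** — the archimedean Weil section of the unitary group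
at a real place `v = w|_F` of `F` split in `E = F(δ)`: the `(w, cw)`-component followed by the split-real metaplectic
section of `Weil1964/ArchSplitRealPlaceSection` in the coordinates `1, δ ⊗ 1 = (σ_w δ, -σ_w δ)`, for a lift `x` of
`splitCayleyDot⁻¹`. [cite: Kudla1994, §3; BorelJacquet1979, §4.1] -/
def archSectionRealSplit (hcc : c * c = 1) (w : {w : InfinitePlace E // IsReal w}) (T : Matrix (Fin N) (Fin N) F)
    {J : Matrix (Fin N) (Fin N) E} (hJ : J = T.map (algebraMap F E)) {δ : E} (hδ : δ ≠ 0) (x : MpS (Fin N)) :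
    arch F E c N J →* MpS (Fin N) :=
  (archSplitSection (isQuadraticCoordinates_splitReal (embedding_of_isReal w.2 δ) (embedding_of_isReal_ne_zero E w hδ))
      rfl (Fin N) x).comp (archAtRealSplit F E c N hcc w T hJ)

omit [NumberField E] [NumberField F] in
/-- **it is a SECTION**: `proj ∘ archSectionRealSplit = toSymplecticDot ∘ archAtRealSplit` whenever
`proj x = splitCayleyDot⁻¹` — the metaplectic cover splits HOMOMORPHICALLY over the `v`-component of `U(J)(E ⊗ ℝ)` at a
real place `v` of `F` split in `E`. [cite: Kudla1994, §3] -/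
theorem proj_comp_archSectionRealSplit (hcc : c * c = 1) (w : {w : InfinitePlace E // IsReal w})
    (T : Matrix (Fin N) (Fin N) F) (hT : T.IsSymm) (hTd : IsUnit T.det)
    {J : Matrix (Fin N) (Fin N) E} (hJ : J = T.map (algebraMap F E)) {δ : E} (hδ : δ ≠ 0) (x : MpS (Fin N))
    (hx : MpS.proj x = (splitCayleyDot (two_mul_mul_inv_two_mul (embedding_of_isReal w.2 δ)
      (embedding_of_isReal_ne_zero E w hδ)) (Fin N) (isUnit_det_map (realEmbOfPlace F E w) hTd)
        (hT.map (realEmbOfPlace F E w)))⁻¹) :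
    MpS.proj.comp (archSectionRealSplit F E c N hcc w T hJ hδ x) =
      (toSymplecticDotSplitReal (embedding_of_isReal w.2 δ) (embedding_of_isReal_ne_zero E w hδ) (Fin N)
          (isUnit_det_map (realEmbOfPlace F E w) hTd) rfl (hT.map (realEmbOfPlace F E w))).comp
        (archAtRealSplit F E c N hcc w T hJ) := by
  rw [archSectionRealSplit, ← MonoidHom.comp_assoc,
    proj_comp_archSplitSection_splitReal _ _ (Fin N) (isUnit_det_map (realEmbOfPlace F E w) hTd) rfl
      (hT.map (realEmbOfPlace F E w)) x hx]

omit [NumberField E] [NumberField F] in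
/-- the `g₊`-parameter of the section is the `w`-COMPONENT `g_w ∈ GL_N(ℝ)` of `g`: entries `(gᵢⱼ)_w`.
[cite: Kudla1994, §3] -/
theorem coe_plusGL_archAtRealSplit (hcc : c * c = 1) (w : {w : InfinitePlace E // IsReal w})
    (T : Matrix (Fin N) (Fin N) F) {J : Matrix (Fin N) (Fin N) E} (hJ : J = T.map (algebraMap F E)) {δ : E} (hδ : δ ≠ 0)
    (g : arch F E c N J) (i j : Fin N) :
    (((isQuadraticCoordinates_splitReal (embedding_of_isReal w.2 δ) (embedding_of_isReal_ne_zero E w hδ)).plusGL rfl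
        (Fin N) (archAtRealSplit F E c N hcc w T hJ g : unitaryGroupOfForm _ _) : GL (Fin N) ℝ) : Matrix (Fin N) (Fin N) ℝ)
        i j =
      ((((g : GL (Fin N) (mixedSpace E)) : Matrix (Fin N) (Fin N) (mixedSpace E)) i j).1 w) := by
  rw [coe_plusGL_splitReal, Matrix.map_apply, coe_archAtRealSplit]
  rfl

omit [NumberField E] [NumberField F] in
/-- **strong continuity of the section**: every orbit map `g ↦ S_{archSectionRealSplit g} f` is continuous on
`U(J)(E ⊗ ℝ)` (the hypothesis `hsc` of `AdelicMetaplecticArchSection.continuous_archLift`).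
[cite: Kudla1994, §3; BorelJacquet1979, §4.1] -/
theorem continuous_archSectionRealSplit_snd_apply (hcc : c * c = 1) (w : {w : InfinitePlace E // IsReal w})
    (T : Matrix (Fin N) (Fin N) F) {J : Matrix (Fin N) (Fin N) E} (hJ : J = T.map (algebraMap F E)) {δ : E} (hδ : δ ≠ 0)
    (x : MpS (Fin N)) (f : SchwartzMap (Fin N → ℝ) ℂ) :
    Continuous fun g : arch F E c N J => (archSectionRealSplit F E c N hcc w T hJ hδ x g).1.2 f := by
  have hev : Continuous ((isQuadraticCoordinates_splitReal (embedding_of_isReal w.2 δ)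
      (embedding_of_isReal_ne_zero E w hδ)).evalPlus rfl : ℝ × ℝ → ℝ) :=
    continuous_fst.congr fun z => (evalPlus_splitReal _ _ z).symm
  have hplus : Continuous fun g : unitaryGroupOfForm (RingEquiv.prodComm : ℝ × ℝ ≃+* ℝ × ℝ).toRingHom
      ((T.map (realEmbOfPlace F E w)).map ((RingHom.id ℝ).prod (RingHom.id ℝ))) =>
        ((((isQuadraticCoordinates_splitReal (embedding_of_isReal w.2 δ) (embedding_of_isReal_ne_zero E w hδ)).plusGL
          rfl (Fin N) (g : GL (Fin N) (ℝ × ℝ)))⁻¹ : GL (Fin N) ℝ) : Matrix (Fin N) (Fin N) ℝ) :=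
    Units.continuous_coe_inv.comp ((hev.generalLinearGroup_map :
      Continuous (Matrix.GeneralLinearGroup.map (n := Fin N) _)).comp continuous_subtype_val)
  exact (continuous_archSplitSection_snd_apply _ rfl (Fin N) x hplus f).comp
    (continuous_archAtRealSplit F E c N hcc w T hJ)

end Rational

end UnitaryGroup

end Literature.NumberTheory.Automorphic

end
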